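import Literature.Geometry.Riemannian.SphericalCylinderSmallScaleDominationProofs
import HarnessLib

/-!
# Route `CylinderEntropy`, item `ImmortalAreaToFloor` (stmt-SmoothPoincare4-17197):
# the zonal heat kernel of `S⁴` dominates a CHORDAL Gaussian on caps (Cheeger–Yau, chordal form)

Brick (KM, kernel half) of the Allard-free blueprint for the residual `ThinSeq` of the item (evidence
`ANALYSIS-prover-17197-c1.md`, §6, CASE 0): the typed cylinder density integrates `zonal τ ⟪y, x⟫` over the shadow,
and the Gaussian-mass bricks (`…GaussianMass.lean`, `…GaussianMassSphere.lean`) are stated for the CHORDAL Gaussian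
`e^{-b ‖y - x‖²}`.  The bridge is the tree's PROVED Cheeger–Yau bound (`CheegerYauZonalSphereFour_holds`:
`(8π²/3)(4πσ)⁻² e^{-arccos(c)²/4σ} ≤ zonal σ c`) together with the elementary comparison of the geodesic and the
chordal distance on the unit sphere proved here:

* `arccos_sq_le` — `arccos(c)² ≤ 4 (1 - c)/(1 + c)` for `-1 < c ≤ 1` (`θ/2 ≤ tan(θ/2)` and the half-angle formulas:
  with `θ = arccos c`, `tan²(θ/2) = (1 - c)/(1 + c)`);
* `arccos_inner_sq_le` — for unit vectors `x, y` of a real inner product space with `‖y - x‖ ≤ R ≤ 1`: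
  `arccos ⟪y, x⟫² ≤ (1 + R²/3) ‖y - x‖²` (`‖y - x‖² = 2 - 2⟪y, x⟫`);
* **`gaussian_chordal_le_zonal`** — for `x, y ∈ S⁴ ⊂ EuclideanSpace ℝ (Fin 5)` with `‖y - x‖ ≤ R ≤ 1` and `σ > 0`:
  `(8π²/3) (4πσ)⁻² exp(-(1 + R²/3) ‖y - x‖²/(4σ)) ≤ zonal σ (∑ i, y i * x i)`.

Everything is proved; no definition, no named fact.

References: E. B. Davies, *Heat kernels and spectral theory* (1989), Thm. 5.6.1 (Cheeger–Yau); the chordal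
comparison is elementary.
-/

noncomputable section

-- the prescribed namespace `Summit.SmoothPoincare4.SmoothPoincare4.…` repeats `SmoothPoincare4`
set_option linter.dupNamespace false

open Real
open scoped BigOperators RealInnerProductSpace

namespace Summit.SmoothPoincare4.SmoothPoincare4.Theorems.GaussianMass

/-- **Geodesic versus chordal distance on the unit circle/sphere**: `arccos(c)² ≤ 4(1-c)/(1+c)` for `-1 < c ≤ 1`.
With `θ = arccos c ∈ [0, π)` and `u = θ/2 ∈ [0, π/2)`: `u ≤ tan u` (`Real.le_tan`), `cos² u = (1+c)/2`,
`sin² u = (1-c)/2`, so `θ² = 4u² ≤ 4 tan² u = 4(1-c)/(1+c)`. [folklore] -/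
theorem arccos_sq_le {c : ℝ} (hc : -1 < c) (hc1 : c ≤ 1) : arccos c ^ 2 ≤ 4 * (1 - c) / (1 + c) := by
  set θ := arccos c with hθ
  set u := θ / 2 with hu
  have hθ0 : 0 ≤ θ := arccos_nonneg c
  have hθπ : θ < π := arccos_lt_pi.2 hc
  have hu0 : 0 ≤ u := by rw [hu]; linarith
  have huπ : u < π / 2 := by rw [hu]; linarith
  have hcos : cos θ = c := cos_arccos hc.le hc1
  -- half-angle formulas
  have hcos2 : cos u ^ 2 = (1 + c) / 2 := by
    have h := cos_sq u
    rw [show 2 * u = θ by rw [hu]; ring, hcos] at h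
    rw [h]; ring
  have hsin2 : sin u ^ 2 = (1 - c) / 2 := by
    have h := sin_sq_add_cos_sq u
    rw [hcos2] at h
    linarith
  have hcpos : 0 < cos u := cos_pos_of_mem_Ioo ⟨by linarith, huπ⟩
  have htan : u ≤ tan u := le_tan hu0 huπ
  have htan2 : u ^ 2 ≤ tan u ^ 2 := pow_le_pow_left₀ hu0 htan 2
  have h1c : 0 < 1 + c := by linarith
  have htansq : tan u ^ 2 = (1 - c) / (1 + c) := by
    rw [tan_eq_sin_div_cos, div_pow, hsin2, hcos2]
    field_simp
  have hθu : θ = 2 * u := by rw [hu]; ring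
  rw [htansq] at htan2
  calc θ ^ 2 = 4 * u ^ 2 := by rw [hθu]; ring
    _ ≤ 4 * ((1 - c) / (1 + c)) := by gcongr
    _ = 4 * (1 - c) / (1 + c) := by ring

/-- **Chordal form on unit vectors**: for unit vectors `x, y` of a real inner product space with `‖y - x‖ ≤ R ≤ 1`,
`arccos ⟪y, x⟫² ≤ (1 + R²/3) ‖y - x‖²` (`‖y - x‖² = 2 - 2⟪y,x⟫`, `arccos_sq_le`, and
`2/(1 + c) ≤ 1/(1 - R²/4) ≤ 1 + R²/3` for `2 - 2c ≤ R² ≤ 1`). [folklore] -/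
theorem arccos_inner_sq_le {F : Type*} [NormedAddCommGroup F] [InnerProductSpace ℝ F] {x y : F}
    (hx : ‖x‖ = 1) (hy : ‖y‖ = 1) {R : ℝ} (hR : ‖y - x‖ ≤ R) (hR1 : R ≤ 1) :
    arccos ⟪y, x⟫ ^ 2 ≤ (1 + R ^ 2 / 3) * ‖y - x‖ ^ 2 := by
  have hd : ‖y - x‖ ^ 2 = 2 - 2 * ⟪y, x⟫ := by
    rw [norm_sub_sq_real, hx, hy]; ring
  set c : ℝ := ⟪y, x⟫ with hc
  have hc1 : c ≤ 1 := by
    have h := real_inner_le_norm y x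
    rw [hx, hy, mul_one] at h
    exact h
  have hd0 : 0 ≤ ‖y - x‖ := norm_nonneg _
  have hdR : ‖y - x‖ ^ 2 ≤ R ^ 2 := pow_le_pow_left₀ hd0 hR 2
  have hR0 : 0 ≤ R := hd0.trans hR
  have hRsq1 : R ^ 2 ≤ 1 := by nlinarith
  -- `c ≥ 1 - R²/2 ≥ 1/2 > -1`
  have hclo : 1 - R ^ 2 / 2 ≤ c := by nlinarith
  have hcm1 : -1 < c := by linarith
  have h1c : 0 < 1 + c := by linarith
  have key := arccos_sq_le hcm1 hc1
  rw [hd]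
  calc arccos c ^ 2 ≤ 4 * (1 - c) / (1 + c) := key
    _ = (2 / (1 + c)) * (2 - 2 * c) := by field_simp; ring
    _ ≤ (1 + R ^ 2 / 3) * (2 - 2 * c) := by
        have h22 : 0 ≤ 2 - 2 * c := by linarith
        apply mul_le_mul_of_nonneg_right _ h22
        rw [div_le_iff₀ h1c]
        nlinarith

/-- **The zonal heat kernel of `S⁴` dominates a chordal Gaussian on caps (Cheeger–Yau, chordal form).** For
`x, y` on the unit sphere of `EuclideanSpace ℝ (Fin 5)` with `‖y - x‖ ≤ R ≤ 1` and `σ > 0`: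
`(8π²/3) (4πσ)⁻² exp(-(1 + R²/3) ‖y - x‖²/(4σ)) ≤ zonal σ (∑ i, y i * x i)` — the tree's PROVED Cheeger–Yau bound
`CheegerYauZonalSphereFour_holds` at `c = ⟪y, x⟫ = ∑ i, y i * x i` and `arccos_inner_sq_le`.
[cite: Davies1989, Thm 5.6.1] -/
theorem gaussian_chordal_le_zonal {x y : EuclideanSpace ℝ (Fin 5)} (hx : ‖x‖ = 1) (hy : ‖y‖ = 1) {R σ : ℝ}
    (hR : ‖y - x‖ ≤ R) (hR1 : R ≤ 1) (hσ : 0 < σ) :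
    (8 * π ^ 2 / 3) * ((4 * π * σ) ^ 2)⁻¹ * exp (-((1 + R ^ 2 / 3) * ‖y - x‖ ^ 2) / (4 * σ)) ≤
      Literature.Geometry.Riemannian.SphericalCylinderEntropy.zonal σ (∑ i, y i * x i) := by
  have hinner : (∑ i, y i * x i) = ⟪y, x⟫ := by
    rw [PiLp.inner_apply]
    refine Finset.sum_congr rfl fun i _ => ?_
    simp [mul_comm]
  have hc1 : ⟪y, x⟫ ≤ 1 := by
    have h := real_inner_le_norm y x
    rwa [hx, hy, mul_one] at h
  have hcm1 : -1 ≤ ⟪y, x⟫ := by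
    have h := neg_le_of_abs_le (abs_real_inner_le_norm y x)
    rwa [hx, hy, mul_one] at h
  have hCY := Literature.Geometry.Riemannian.CheegerYauZonalSphereFour_holds σ hσ ⟪y, x⟫ hcm1 hc1
  rw [hinner]
  refine le_trans ?_ hCY
  have hpre : 0 ≤ (8 * π ^ 2 / 3) * ((4 * π * σ) ^ 2)⁻¹ := by positivity
  apply mul_le_mul_of_nonneg_left _ hpre
  rw [exp_le_exp, neg_div, neg_div, neg_le_neg_iff]
  exact div_le_div_of_nonneg_right (arccos_inner_sq_le hx hy hR hR1) (by positivity)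

end Summit.SmoothPoincare4.SmoothPoincare4.Theorems.GaussianMass

end
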